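import Summits.CriticalPhenomena.PercolationContinuityZ3.Theorems.PercNearOneGluingNoHeavyLowerTailSahiHardCoreReduction
import Literature.Combinatorics.Sahi2008.ProvedCases
import HarnessLib

/-!
# `NoHeavyLowerTail` (stmt-CriticalPhenomena-4575) — all orders for families whose hard-core triples pass through a CUMULATION (Theorem H ∘ Sahi's Theorem 2)

Support file, seat `prim-l12-p5` (gen 4), `--supports stmt-CriticalPhenomena-4575`.  No definitions, no named facts, no sorries.
Composes `…SahiHardCoreReduction` (Theorem H: `E₃ ≥ 0` on the hard-core sub-triples + fourwise absorption ⇒ `E_m ≥ 0` for every `m`) with the tree's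
FKG form of Sahi's Theorem 2 at `n = 3` (`Literature…sahiE_three_nonneg_of_monotone_of_isLatticeCumulation` [Sahi 2008 Thm 2; Blinovsky]: `E₃(f, g, h) ≥ 0`
for nonnegative monotone `f, g` and a CUMULATION `h` — a nonnegative combination of principal up-set indicators `1_{x ≥ c}`).

* `sahiE_nonneg_of_cumulationCore_of_fourwise` — FKG probability weight on a finite distributive lattice, monotone indicators: if every hard-core sub-triple
  has a cumulation slot and among any four slots one absorbs the product of the other three, then `E_m(g) ≥ 0` for every `m`.  In particular every
  fourwise-absorbing family in which all members but (at most) two are principal up-sets is Sahi-nonnegative at all orders — a class incomparable with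
  Sahi's/Blinovsky's all-cumulation theorem and with the triplewise class of Theorem F.
-/

namespace Summit.CriticalPhenomena.PercolationContinuityZ3.Theorems

namespace SahiHereditaryMeetAbsorption

open Finset Function Literature.Combinatorics.Sahi2008 SahiMomentExpansion SahiDefectExpansion
open scoped Nat

variable {α : Type*} [Fintype α]

/-! ### Composing with Sahi's Theorem 2 (one cumulation slot): hard-core triples through a cumulation are settled -/

section Cumulation

variable [DistribLattice α] [DecidableEq α] [DecidableLE α]

/-- **Hard-core triples through a CUMULATION slot need no further input.**  FKG probability weight on a finite distributive lattice; monotone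
indicators `g_0,…,g_{m−1}`; suppose every hard-core sub-triple `i < j < k` (no slot contains the meet of the other two) has a slot that is a Sahi
CUMULATION (a nonnegative combination of principal up-set indicators, e.g. `1_{x ≥ c}` — `IsLatticeCumulation`, `isLatticeCumulation_setInd_principalUp`),
and among any four slots one absorbs the product of the other three.  Then `E_m(g) ≥ 0` for every `m`.  (Theorem H with its hypothesis (a) discharged
by Sahi's Theorem 2 at `n = 3` in Blinovsky's FKG form, tree `sahiE_three_nonneg_of_monotone_of_isLatticeCumulation`.)  E.g.: any fourwise-absorbing
family all of whose members but two are principal up-sets. [this file] -/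
theorem sahiE_nonneg_of_cumulationCore_of_fourwise {μ : α → ℝ} (hμ : IsFKGMeasure μ) (m : ℕ) (g : Fin m → α → ℝ)
    (h01 : ∀ i a, g i a = 0 ∨ g i a = 1) (hmono : ∀ i, Monotone (g i))
    (hcum : ∀ i j k : Fin m, i < j → j < k → (¬ ∀ x, g j x * g k x ≤ g i x) → (¬ ∀ x, g i x * g k x ≤ g j x) →
      (¬ ∀ x, g i x * g j x ≤ g k x) → IsLatticeCumulation (g i) ∨ IsLatticeCumulation (g j) ∨ IsLatticeCumulation (g k))
    (h4 : ∀ S : Finset (Fin m), S.card = 4 → ∃ p ∈ S, ∀ x, (1 - g p x) * ∏ i ∈ S.erase p, g i x = 0) :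
    0 ≤ sahiE μ m g := by
  have hg0 : ∀ i x, 0 ≤ g i x := fun i x => by rcases h01 i x with e | e <;> simp [e]
  refine sahiE_nonneg_of_hardCore_of_fourwise hμ m g h01 hmono (fun i j k hij hjk ha hb hc => ?_) h4
  rcases hcum i j k hij hjk ha hb hc with h | h | h
  · rw [sahiE_three_swap₁₂, SahiMeetTower.sahiE_three_swap₂₃]
    exact sahiE_three_nonneg_of_monotone_of_isLatticeCumulation hμ (hg0 j) (hmono j) (hg0 k) (hmono k) h
  · rw [SahiMeetTower.sahiE_three_swap₂₃]
    exact sahiE_three_nonneg_of_monotone_of_isLatticeCumulation hμ (hg0 i) (hmono i) (hg0 k) (hmono k) h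
  · exact sahiE_three_nonneg_of_monotone_of_isLatticeCumulation hμ (hg0 i) (hmono i) (hg0 j) (hmono j) h

end Cumulation

end SahiHereditaryMeetAbsorption

end Summit.CriticalPhenomena.PercolationContinuityZ3.Theorems
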